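import Summits.Ventures.WeilGRH.DualTrigKernelFamily
import HarnessLib

/-!
# Format D-K soundness, part 10: a certificate on a GENERAL window `[−t, t]`

Cell `rh-explicit`, WEIL TRACK — GRH ARM, route B (weil-grh-3).  The kernel checker `DKCert.check`
(`DualTrigKernelCheck.lean`) ties the admissibility of the atoms to the rungs `t = log (N+1) / 2`:
`atomsOK` demands `(N+1)^D ≤ p₀^k`, i.e. `k ω ≥ log (N+1)`, `ω = log p₀ / D`.  For a window `[−t, t]`
with `e^{2t} ≤ N + 1` that is NOT of that form (e.g. the arm's rung `t = 59/100`, between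
`(log 3)/2` and `log 2`) the multiplier may use every atom with `k ω ≥ 2t`, which is more than
`atomsOK` allows, while the prime side is the same (`n ≤ N`).  This file records the corresponding
soundness statements; the pointwise part of `DKCert.sound` never used `atomsOK`, so nothing new is
computed:

* `weilPositivityOnChar_of_trigDual_window` — LEMMA D-K on a general window: atoms with frequencies
  `x ≥ 2t`, `e^{2t} ≤ N + 1`, and `0 ≤ M_{χ,N} + T` on `ℝ` give `WeilPositivityOnChar χ t`
  (`weilQuadraticChar_re_eq_weilFinitePrimeQuadraticChar` + the annihilation of the atoms);
* `DKCert.Pθ_nonneg_of_parts` — the certificate function `P(θ) ≥ 0` on `ℝ` from the frame checks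
  `constsOK`, `valsOK`, `blocksOK`, `tailOK` and the cells `cellsOK` (the body of
  `DKCert.Pθ_nonneg_of_check`, which does not use `atomsOK`);
* `DKCert.sound_of_parts`, `DKCert.sound_family_of_parts` — the multiplier inequality at the
  threshold modulus / for the whole key group at every modulus `q ≥ c.q`;
* `DKCert.atomT_freq_ge_of_windowOK` — atom admissibility for the window from INTEGER data: if
  `2·tn·D·S ≤ k·lo(log p₀)·td` for every atom (decidable; `lo(log p₀)` = the claimed, checked lower
  end `c.logp0C.1`), then every atom has frequency `k ω ≥ 2 (tn/td)`;
* `DKCert.weilPositivityOnChar_window_of_parts`, `…_window_family_of_parts` — the rung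
  `WeilPositivityOnChar χ (tn/td)` at the threshold modulus / for the key group at every `q ≥ c.q`.

An instance file evaluates the six Boolean facts by `decide` (the cells by `decide +kernel`) and
discharges `e^{2 tn/td} ≤ N + 1` by an elementary bound.  Everything here is PROVED; no named facts,
no `sorry`, no kernel evaluation.

## References

* A. Weil, *Sur les "formules explicites" de la théorie des nombres premiers* (1952), (11) and the
  «lemme» p. 262 (the hermitian functional on a window).
* H. Yoshida, *On Hermitian forms attached to zeta functions* (1992), §0 (the spaces `C(a)`). [folklore consequences]
-/

noncomputable section

open Finset Real Complex Set MeasureTheory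

namespace Summit.Ventures.WeilGRH

open Literature.Analysis.ValidatedNumerics.NumericsMP
open Literature.NumberTheory.LFunctions
open DualTrigTaylor DigammaVertical

/-! ### LEMMA D-K on a general window -/

section window

variable {q : ℕ} {g : ℝ → ℂ}

/-- **LEMMA D-K on a general window (analytic form).** If `e^{2t} ≤ N + 1`, every atom has frequency
`x ≥ 2t`, and `0 ≤ M_{χ,N}(τ) + T(τ)` for EVERY real `τ`, then `0 ≤ E_{χ,N}(g)` for every test function
`g` with `tsupport g ⊆ [−t, t]`. [folklore] -/
theorem weilFinitePrimeQuadraticChar_nonneg_of_trigDual_window (χ : DirichletCharacter ℂ q) (N : ℕ)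
    {t : ℝ} (l : List TrigAtom) (hx : ∀ A ∈ l, 2 * t ≤ A.x)
    (hP : ∀ τ : ℝ, 0 ≤ weilFinitePrimeWeightChar χ N τ + trigSum l τ)
    (hg : IsWeilTest g) (hsupp : tsupport g ⊆ Icc (-t) t) :
    0 ≤ weilFinitePrimeQuadraticChar χ N g := by
  obtain ⟨hiT, hIT⟩ := integrable_and_integral_norm_sq_weilMellin_mul_trigSum hg hsupp l hx
  have hiM := integrable_norm_sq_weilMellin_mul_weilFinitePrimeWeightChar hg χ N
  unfold weilFinitePrimeQuadraticChar
  have hsum : (∫ τ : ℝ, ‖weilMellin g (1 / 2 + τ * I)‖ ^ 2 * weilFinitePrimeWeightChar χ N τ) =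
      ∫ τ : ℝ, ‖weilMellin g (1 / 2 + τ * I)‖ ^ 2 * (weilFinitePrimeWeightChar χ N τ + trigSum l τ) := by
    have e : (fun τ : ℝ ↦ ‖weilMellin g (1 / 2 + τ * I)‖ ^ 2 *
        (weilFinitePrimeWeightChar χ N τ + trigSum l τ)) =
        fun τ : ℝ ↦ ‖weilMellin g (1 / 2 + τ * I)‖ ^ 2 * weilFinitePrimeWeightChar χ N τ +
          ‖weilMellin g (1 / 2 + τ * I)‖ ^ 2 * trigSum l τ := by
      funext τ; ring
    rw [e, integral_add hiM hiT, hIT, add_zero]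
  rw [hsum]
  refine mul_nonneg (by positivity) (integral_nonneg fun τ ↦ ?_)
  exact mul_nonneg (by positivity) (hP τ)

/-- **LEMMA D-K on a general window (the rung).** For `χ` mod `q ≠ 1`, a window `[−t, t]` with
`e^{2t} ≤ N + 1`, and a multiplier `T = Σ (a cos(xτ) + b sin(xτ))` with all frequencies `x ≥ 2t` and
`M_{χ,N} + T ≥ 0` on `ℝ`: `WeilPositivityOnChar χ t`. [folklore] -/
theorem weilPositivityOnChar_of_trigDual_window (hq : q ≠ 1) (χ : DirichletCharacter ℂ q) (N : ℕ)
    {t : ℝ} (hN : Real.exp (2 * t) ≤ (N : ℝ) + 1)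
    (l : List TrigAtom) (hx : ∀ A ∈ l, 2 * t ≤ A.x)
    (hP : ∀ τ : ℝ, 0 ≤ weilFinitePrimeWeightChar χ N τ + trigSum l τ) :
    WeilPositivityOnChar χ t := by
  intro g hg hsupp
  rw [weilQuadraticChar_re_eq_weilFinitePrimeQuadraticChar hq χ hg hN hsupp]
  exact weilFinitePrimeQuadraticChar_nonneg_of_trigDual_window χ N l hx hP hg hsupp

/-- `e^{2·59/100} ≤ 3 + 1`: on the arm's window `[−59/100, 59/100]` only the prime powers `n ≤ 3`
enter (the hypothesis `hN` of the window theorems below at `tn/td = 59/100`, `N = 3`). [folklore] -/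
theorem exp_two_mul_fiftynine_div_hundred_le :
    Real.exp (2 * (((59 : ℕ) : ℝ) / ((100 : ℕ) : ℝ))) ≤ ((3 : ℕ) : ℝ) + 1 := by
  have h := Real.exp_bound' (x := 59 / 100) (by norm_num) (by norm_num) (n := 10) (by norm_num)
  simp only [Finset.sum_range_succ, Finset.sum_range_zero, Nat.factorial] at h
  norm_num at h
  have e : Real.exp (2 * (((59 : ℕ) : ℝ) / ((100 : ℕ) : ℝ))) = Real.exp (59 / 100) ^ 2 := by
    rw [sq, ← Real.exp_add]; norm_num
  rw [e]; push_cast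
  nlinarith [Real.exp_pos (59 / 100 : ℝ)]

end window

namespace DKCert

variable {c : DKCert}

/-! ### The certificate function is nonnegative from the frame parts (no `atomsOK`) -/

/-- **The certificate function is `≥ 0` everywhere, from the parts of the frame.**  If `constsOK`,
`valsOK`, `blocksOK`, `tailOK` and `cellsOK` hold then `0 ≤ P(θ)` for every real `θ`.  This is the body
of `DKCert.Pθ_nonneg_of_check` (steps (1)–(3) of `DKCert.sound`), which never uses `atomsOK`.
[folklore] -/
theorem Pθ_nonneg_of_parts (hconsts : c.constsOK = true) (hvals : c.valsOK = true)
    (hblocks : c.blocksOK = true) (htail : c.tailOK = true) (hcells : c.cellsOK = true) (θ : ℝ) :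
    0 ≤ c.Pθ θ := by
  obtain ⟨hS, hp0, hD, _, hR, _, hpi, hlog, hrho, hC⟩ := constsOK_sound hconsts
  obtain ⟨hρ, hρω⟩ := rhoR_pos_and_mul hp0 hD
  have hF := terms_repr hS hpi hlog hp0 hvals
  have hSr : (0 : ℝ) < c.S := by exact_mod_cast hS
  obtain ⟨hbs, hchain, b0, bl, h0, hl, hfirst, hlast⟩ := blocksOK_sound hblocks
  have hb0 : b0 ∈ c.blocks := List.mem_of_mem_head? h0
  have hbl : bl ∈ c.blocks := List.mem_of_mem_getLast? hl
  have hMc0 : (0 : ℝ) < b0.Mc := by exact_mod_cast (hbs b0 hb0).1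
  have hMcl : (0 : ℝ) < bl.Mc := by exact_mod_cast (hbs bl hbl).1
  have hend : π ≤ bEnd bl := by
    unfold bEnd; rw [le_div_iff₀ hMcl]
    have : (bl.Mc : ℝ) ≤ 2 * ((bl.j0 : ℝ) + bl.n) := by exact_mod_cast hlast
    nlinarith [Real.pi_pos]
  have hstart0 : bStart b0 ≤ 0 := by
    unfold bStart
    have : (b0.j0 : ℝ) ≤ 0 := by
      split_ifs at hfirst with he
      · exact_mod_cast hfirst
      · have : (2 * b0.j0 : ℝ) ≤ -(b0.Mc : ℝ) := by exact_mod_cast hfirst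
        linarith
    have : 2 * π * (b0.j0 : ℝ) ≤ 0 := by nlinarith [Real.pi_pos]
    exact div_nonpos_of_nonpos_of_nonneg this hMc0.le
  -- (1) the periodic part everywhere
  have hint : ∀ rt ∈ cList c.terms c.termsR, ∃ k : ℤ, rt.κ = k :=
    cList_int c.terms c.termsR hF isInt_of_comm
  have hT : ∀ θ : ℝ, (c.mT : ℝ) / c.S ≤ sumVal (cList c.terms c.termsR) θ := by
    intro θ
    set k : ℤ := ⌊(θ + π) / (2 * π)⌋ with hk
    set θ' : ℝ := θ - k * (2 * π) with hθ'
    have h2π : (0 : ℝ) < 2 * π := by positivity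
    have hθ'1 : -π ≤ θ' := by
      have := Int.floor_le ((θ + π) / (2 * π))
      rw [← hk, le_div_iff₀ h2π] at this; rw [hθ']; linarith
    have hθ'2 : θ' ≤ π := by
      have := Int.lt_floor_add_one ((θ + π) / (2 * π))
      rw [← hk, div_lt_iff₀ h2π] at this; rw [hθ']; linarith
    have hper : sumVal (cList c.terms c.termsR) θ = sumVal (cList c.terms c.termsR) θ' := by
      rw [hθ', show θ - k * (2 * π) = θ + (-k : ℤ) * (2 * π) by push_cast; ring]
      exact (sumVal_add_int_mul _ hint θ (-k)).symm
    rw [hper]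
    by_cases he : c.even = true
    · have hevenB : ∀ t ∈ cList c.terms c.termsR, t.B = 0 :=
        fun t ht ↦ termsR_B_zero hvals he t (mem_of_mem_cList _ _ t ht)
      rcases le_total 0 θ' with hpos | hneg
      · exact T_ge_of_covered hS hpi hrho hρ hC hR hF hblocks hcells h0 hl (hstart0.trans hpos)
          (hθ'2.trans hend) hθ'1 hθ'2
      · rw [← sumVal_neg _ hevenB θ']
        exact T_ge_of_covered hS hpi hrho hρ hC hR hF hblocks hcells h0 hl (by linarith) (by linarith)
          (by linarith) (by linarith)
    · have hstartπ : bStart b0 ≤ -π := by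
        rw [Bool.not_eq_true] at he; simp only [he] at hfirst
        unfold bStart; rw [div_le_iff₀ hMc0]
        have : (2 * b0.j0 : ℝ) ≤ -(b0.Mc : ℝ) := by exact_mod_cast hfirst
        nlinarith [Real.pi_pos]
      exact T_ge_of_covered hS hpi hrho hρ hC hR hF hblocks hcells h0 hl (hstartπ.trans hθ'1)
        (hθ'2.trans hend) hθ'1 hθ'2
  -- (2) the tail
  have hnc : ∀ θ : ℝ, -(((c.bInc : ℤ) : ℝ) / c.S) ≤ sumVal (ncList c.terms c.termsR) θ := by
    intro θ
    have h1 := neg_sum_abs_le_sumVal (ncList c.terms c.termsR) θ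
    have h2 := ncList_abs_le hS c.terms c.termsR hF
    unfold bInc
    linarith
  unfold tailOK at htail
  simp only [h0, hl, Bool.and_eq_true, Bool.or_eq_true] at htail
  obtain ⟨htl, htf⟩ := htail
  have tail_of : ∀ (Mc : ℕ) (jj : ℤ), 1 ≤ Mc →
      (match c.psiTailLo Mc jj with | some v => decide (0 ≤ v + c.constI.lo - c.bInc + c.mT) | none => false) = true →
      ∀ θ : ℝ, 2 * π * |(jj : ℝ)| / Mc ≤ |θ| → 0 ≤ c.Pθ θ := by
    intro Mc jj hMc h θ hθ
    cases hv : c.psiTailLo Mc jj with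
    | none => simp [hv] at h
    | some v =>
      simp only [hv, decide_eq_true_eq] at h
      have hψ := psiTailLo_sound hS hpi hrho hρ hMc jj hv hθ
      have hCr : ((c.constI.lo : ℤ) : ℝ) / c.S ≤ c.constR := lo_le hS hC
      have hsplit : sumVal c.termsR θ = sumVal (cList c.terms c.termsR) θ + sumVal (ncList c.terms c.termsR) θ := by
        rw [sumVal_cList c.terms c.termsR hF θ]; ring
      have hz : (0 : ℝ) ≤ ((v + c.constI.lo - c.bInc + c.mT : ℤ) : ℝ) / c.S := by
        have : (0 : ℝ) ≤ ((v + c.constI.lo - c.bInc + c.mT : ℤ) : ℝ) := by exact_mod_cast h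
        positivity
      unfold Pθ; rw [hsplit]
      push_cast at hz
      have := hT θ; have := hnc θ
      rw [add_div, sub_div, add_div] at hz
      linarith
  -- (3) every θ: first for θ ≥ bStart b0
  have hge : ∀ θ : ℝ, bStart b0 ≤ θ → 0 ≤ c.Pθ θ := by
    intro θ hθ
    rcases le_total θ (bEnd bl) with hle | hgt
    · exact Pθ_nonneg_of_covered hS hpi hrho hρ hC hR hF hblocks hcells h0 hl hθ hle
    · refine tail_of bl.Mc (bl.j0 + bl.n) (hbs bl hbl).1 htl θ ?_
      have hjj : (0 : ℝ) ≤ ((bl.j0 + bl.n : ℤ) : ℝ) := by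
        have : 0 < bEnd bl := lt_of_lt_of_le Real.pi_pos hend
        unfold bEnd at this
        have := (div_pos_iff_of_pos_right hMcl).1 this
        push_cast; nlinarith [Real.pi_pos]
      rw [abs_of_nonneg hjj]
      have : bEnd bl = 2 * π * ((bl.j0 + bl.n : ℤ) : ℝ) / bl.Mc := by unfold bEnd; push_cast; ring
      rw [← this]
      exact hgt.trans (le_abs_self θ)
  rcases le_total (bStart b0) θ with hθ | hθ
  · exact hge θ hθ
  · by_cases he : c.even = true
    · rw [← Pθ_neg hvals he θ]
      exact hge (-θ) (by linarith)
    · rw [Bool.not_eq_true] at he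
      simp only [he, Bool.false_eq_true, false_or] at htf
      refine tail_of b0.Mc b0.j0 (hbs b0 hb0).1 htf θ ?_
      simp only [he, Bool.false_eq_true, if_false] at hfirst
      have hj0 : (b0.j0 : ℝ) ≤ 0 := by
        have : (2 * b0.j0 : ℝ) ≤ -(b0.Mc : ℝ) := by exact_mod_cast hfirst
        linarith
      rw [abs_of_nonpos hj0]
      have hθ0 : θ ≤ 0 := hθ.trans hstart0
      rw [abs_of_nonpos hθ0]
      unfold bStart at hθ
      have : 2 * π * -(b0.j0 : ℝ) / b0.Mc = -(2 * π * b0.j0 / b0.Mc) := by ring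
      rw [this]; linarith

/-! ### The multiplier inequality from the parts -/

/-- **Soundness from the parts, threshold modulus.**  For every Dirichlet character `χ` mod `c.q` of
parity `c.par` taking the claimed window values, `0 ≤ M_{χ,N}(τ) + Σ_k (a_k cos(kωτ) + b_k sin(kωτ))`
for every real `τ` (step (4) of `DKCert.sound`). [folklore] -/
theorem sound_of_parts (hconsts : c.constsOK = true) (hvals : c.valsOK = true)
    (hnodup : c.valsNodup = true) (hblocks : c.blocksOK = true) (htail : c.tailOK = true)
    (hcells : c.cellsOK = true) (χ : DirichletCharacter ℂ c.q) (hpar : charParity χ = c.par)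
    (hχ : ∀ val ∈ c.vals, χ (val.n : ZMod c.q) = valZ val) (τ : ℝ) :
    0 ≤ weilFinitePrimeWeightChar χ c.N τ + trigSum (c.atoms.map c.atomT) τ := by
  have hmain := Pθ_nonneg_of_parts hconsts hvals hblocks htail hcells (c.omegaR * τ)
  obtain ⟨_, hp0, hD, _, _, _, _, _, _, _⟩ := constsOK_sound hconsts
  obtain ⟨_, hρω⟩ := rhoR_pos_and_mul hp0 hD
  unfold Pθ at hmain
  have hval := sumVal_valsR_eq (χ := χ) hp0 hD hvals (by
    unfold valsNodup at hnodup; simpa using hnodup) hχ τ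
  unfold termsR at hmain
  rw [sumVal_append, sumVal_atoms, hval] at hmain
  unfold weilFinitePrimeWeightChar
  have harg : (c.sigR : ℂ) + ((c.rhoR * (c.omegaR * τ) : ℝ) : ℂ) * I =
      1 / 4 + (charParity χ : ℂ) / 2 + (τ : ℂ) / 2 * I := by
    rw [← mul_assoc, hρω, hpar]
    unfold sigR
    push_cast; ring
  rw [harg] at hmain
  unfold constR at hmain
  linarith

/-- **Soundness from the parts, whole key group.**  For every modulus `q ≥ c.q` and every Dirichlet
character `χ` mod `q` of parity `c.par` taking the claimed values at the listed prime powers and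
vanishing at the prime powers `n ≤ N` not coprime to `c.q`, `0 ≤ M_{χ,N}(τ) + T(τ)` for every real
`τ`. [folklore] -/
theorem sound_family_of_parts (hconsts : c.constsOK = true) (hvals : c.valsOK = true)
    (hnodup : c.valsNodup = true) (hblocks : c.blocksOK = true) (htail : c.tailOK = true)
    (hcells : c.cellsOK = true) {q : ℕ} (hq : c.q ≤ q) (χ : DirichletCharacter ℂ q)
    (hpar : charParity χ = c.par) (hχ : ∀ val ∈ c.vals, χ (val.n : ZMod q) = valZ val)
    (hχ0 : ∀ n : ℕ, n ≤ c.N → IsPrimePow n → ¬ Nat.Coprime n c.q → χ (n : ZMod q) = 0) (τ : ℝ) :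
    0 ≤ weilFinitePrimeWeightChar χ c.N τ + trigSum (c.atoms.map c.atomT) τ := by
  have hmain := Pθ_nonneg_of_parts hconsts hvals hblocks htail hcells (c.omegaR * τ)
  obtain ⟨_, hp0, hD, _, _, _, _, _, _, _⟩ := constsOK_sound hconsts
  obtain ⟨_, hρω⟩ := rhoR_pos_and_mul hp0 hD
  unfold Pθ at hmain
  have hval := sumVal_valsR_eq_family (χ := χ) hp0 hD hvals (by
    unfold valsNodup at hnodup; simpa using hnodup) hχ hχ0 τ
  unfold termsR at hmain
  rw [sumVal_append, sumVal_atoms, hval] at hmain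
  unfold weilFinitePrimeWeightChar
  have harg : (c.sigR : ℂ) + ((c.rhoR * (c.omegaR * τ) : ℝ) : ℂ) * I =
      1 / 4 + (charParity χ : ℂ) / 2 + (τ : ℂ) / 2 * I := by
    rw [← mul_assoc, hρω, hpar]
    unfold sigR
    push_cast; ring
  rw [harg] at hmain
  unfold constR at hmain
  have hlog := log_threshold_le (c := c) hq
  linarith

/-! ### Atom admissibility for a window from integer data -/

/-- **Window admissibility of the atoms.**  If `constsOK` holds (so the claimed lower end `c.logp0C.1`
is at most `S · log p₀`) and every atom satisfies `2·tn·D·S ≤ k·c.logp0C.1·td` (integers), then every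
atom has frequency `k ω ≥ 2 (tn / td)`. [folklore] -/
theorem atomT_freq_ge_of_windowOK (hconsts : c.constsOK = true) {tn td : ℕ} (htd : 0 < td)
    (hwin : (c.atoms.all fun atm =>
      decide ((2 * tn * c.D * c.S : ℤ) ≤ (atm.k : ℤ) * c.logp0C.1 * td)) = true) :
    ∀ A ∈ c.atoms.map c.atomT, 2 * ((tn : ℝ) / td) ≤ A.x := by
  obtain ⟨hS, hp0, hD, _, _, _, _, hlog, _, _⟩ := constsOK_sound hconsts
  intro A hA
  rw [List.mem_map] at hA
  obtain ⟨atm, hatm, rfl⟩ := hA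
  rw [List.all_eq_true] at hwin
  have h := hwin atm hatm
  rw [decide_eq_true_eq] at h
  simp only [atomT, omegaR]
  have hSr : (0 : ℝ) < c.S := by exact_mod_cast hS
  have hDr : (0 : ℝ) < c.D := by exact_mod_cast hD
  have htdr : (0 : ℝ) < td := by exact_mod_cast htd
  have hk0 : (0 : ℝ) ≤ atm.k := Nat.cast_nonneg _
  have hlo : ((c.logp0C.1 : ℤ) : ℝ) / c.S ≤ Real.log c.p0 := lo_le hS hlog
  rw [div_le_iff₀ hSr] at hlo
  have hr : ((2 * tn * c.D * c.S : ℤ) : ℝ) ≤ ((atm.k * c.logp0C.1 * td : ℤ) : ℝ) := by exact_mod_cast h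
  push_cast at hr
  have hkt : (atm.k : ℝ) * (c.logp0C.1 : ℝ) * td ≤ atm.k * (Real.log c.p0 * c.S) * td :=
    mul_le_mul_of_nonneg_right (mul_le_mul_of_nonneg_left hlo hk0) htdr.le
  have hmain : (2 * tn * c.D : ℝ) * c.S ≤ (atm.k * Real.log c.p0 * td) * c.S := by nlinarith
  have hmain' : (2 * tn * c.D : ℝ) ≤ atm.k * Real.log c.p0 * td := le_of_mul_le_mul_right hmain hSr
  rw [show (2 : ℝ) * ((tn : ℝ) / td) = 2 * tn / td by ring, div_le_iff₀ htdr,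
    show (atm.k : ℝ) * (Real.log c.p0 / c.D) * td = atm.k * Real.log c.p0 * td / c.D by ring,
    le_div_iff₀ hDr]
  exact hmain'

/-! ### The rung on a general window -/

/-- **The rung on a general window, threshold modulus.**  From the frame parts, the cells, the
integer window condition on the atoms and `e^{2 tn/td} ≤ N + 1`: for `c.q ≠ 1` and every Dirichlet
character `χ` mod `c.q` of parity `c.par` with the claimed window values,
`WeilPositivityOnChar χ (tn / td)`. [folklore] -/
theorem weilPositivityOnChar_window_of_parts (hconsts : c.constsOK = true) (hvals : c.valsOK = true)
    (hnodup : c.valsNodup = true) (hblocks : c.blocksOK = true) (htail : c.tailOK = true)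
    (hcells : c.cellsOK = true) {tn td : ℕ} (htd : 0 < td)
    (hwin : (c.atoms.all fun atm =>
      decide ((2 * tn * c.D * c.S : ℤ) ≤ (atm.k : ℤ) * c.logp0C.1 * td)) = true)
    (hN : Real.exp (2 * ((tn : ℝ) / td)) ≤ (c.N : ℝ) + 1)
    (hq : c.q ≠ 1) (χ : DirichletCharacter ℂ c.q) (hpar : charParity χ = c.par)
    (hχ : ∀ val ∈ c.vals, χ (val.n : ZMod c.q) = valZ val) :
    WeilPositivityOnChar χ ((tn : ℝ) / td) :=
  weilPositivityOnChar_of_trigDual_window hq χ c.N hN (c.atoms.map c.atomT)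
    (atomT_freq_ge_of_windowOK hconsts htd hwin)
    (sound_of_parts hconsts hvals hnodup hblocks htail hcells χ hpar hχ)

/-- **The rung on a general window, whole key group.**  Same, for every modulus `q ≥ c.q`, `q ≠ 1`,
and every Dirichlet character `χ` mod `q` of parity `c.par` with the claimed values at the listed prime
powers and `χ(n) = 0` at the prime powers `n ≤ N` not coprime to `c.q`:
`WeilPositivityOnChar χ (tn / td)`. [folklore] -/
theorem weilPositivityOnChar_window_family_of_parts (hconsts : c.constsOK = true)
    (hvals : c.valsOK = true) (hnodup : c.valsNodup = true) (hblocks : c.blocksOK = true)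
    (htail : c.tailOK = true) (hcells : c.cellsOK = true) {tn td : ℕ} (htd : 0 < td)
    (hwin : (c.atoms.all fun atm =>
      decide ((2 * tn * c.D * c.S : ℤ) ≤ (atm.k : ℤ) * c.logp0C.1 * td)) = true)
    (hN : Real.exp (2 * ((tn : ℝ) / td)) ≤ (c.N : ℝ) + 1)
    {q : ℕ} (hq : c.q ≤ q) (hq1 : q ≠ 1) (χ : DirichletCharacter ℂ q) (hpar : charParity χ = c.par)
    (hχ : ∀ val ∈ c.vals, χ (val.n : ZMod q) = valZ val)
    (hχ0 : ∀ n : ℕ, n ≤ c.N → IsPrimePow n → ¬ Nat.Coprime n c.q → χ (n : ZMod q) = 0) :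
    WeilPositivityOnChar χ ((tn : ℝ) / td) :=
  weilPositivityOnChar_of_trigDual_window hq1 χ c.N hN (c.atoms.map c.atomT)
    (atomT_freq_ge_of_windowOK hconsts htd hwin)
    (sound_family_of_parts hconsts hvals hnodup hblocks htail hcells hq χ hpar hχ hχ0)

end DKCert

end Summit.Ventures.WeilGRH

end
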